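import Mathlib
import Summits.Ventures.DiscreteObjects.Mahler.SelmerTrinomial

/-!
# Selmer's theorem, second family: `xⁿ + x + 1` is irreducible for `n ≢ 2 (mod 3)` (venture `DiscreteObjects`, target L)

Cell `pub-namedobj`, seat `pub-namedobj-mahler` (gen 9). Framing: lottery ticket; floor = certified
bounds/negative ranges.

Selmer (1956) also proved that `zⁿ + z + 1` is irreducible over `ℤ` when `n ≢ 2 (mod 3)` (for
`n ≡ 2 (mod 3)` it is divisible by `z² + z + 1`).  Same route as `SelmerTrinomial` ([McKee–Smyth,
Exercise 12.4]): Landau gives `M(zⁿ + z + 1) ≤ √3 < θ₀²`, and a root pair `β, β⁻¹` forces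
`β² + β + 1 = 0` and `β^{n-2} = 1`, i.e. `3 ∣ n - 2`.

* `X_pow_add_X_add_one_no_inverse_pair` — no root pair unless `3 ∣ n - 2`;
* `irreducible_X_pow_add_X_add_one` — **`zⁿ + z + 1` is irreducible for `n ≥ 2`, `n % 3 ≠ 2`**.
-/

namespace Summit.Ventures.DiscreteObjects.Mahler

open Polynomial Finset

/-- `βⁿ = -β - 1` and `β⁻ⁿ = -β⁻¹ - 1` (`n = m + 2`, `β ≠ 0`) force `3 ∣ m`. -/
theorem X_pow_add_X_add_one_no_inverse_pair {m : ℕ} (hm : m % 3 ≠ 0) {β : ℂ} (hβ : β ≠ 0)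
    (h1 : β ^ (m + 2) + β + 1 = 0) (h2 : β⁻¹ ^ (m + 2) + β⁻¹ + 1 = 0) : False := by
  have key : 1 + β ^ (m + 1) + β ^ (m + 2) = 0 := by
    have e1 : β⁻¹ ^ (m + 2) * β ^ (m + 2) = 1 := by rw [← mul_pow, inv_mul_cancel₀ hβ, one_pow]
    have e2 : β⁻¹ * β ^ (m + 2) = β ^ (m + 1) := by
      rw [pow_succ, mul_comm, mul_assoc, mul_inv_cancel₀ hβ, mul_one]
    have e : (β⁻¹ ^ (m + 2) + β⁻¹ + 1) * β ^ (m + 2) =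
        β⁻¹ ^ (m + 2) * β ^ (m + 2) + β⁻¹ * β ^ (m + 2) + β ^ (m + 2) := by ring
    rw [h2, zero_mul, e1, e2] at e
    linear_combination -e
  have hA : β ^ m * β = 1 * β := by linear_combination key - h1
  have hBm : β ^ m = 1 := mul_right_cancel₀ hβ hA
  have hC : β ^ 2 + β + 1 = 0 := by linear_combination h1 - β ^ 2 * hBm
  have hD : β ^ 3 = 1 := by linear_combination (β - 1) * hC
  have hmod : β ^ m = β ^ (m % 3) := by
    conv_lhs => rw [← Nat.div_add_mod m 3, pow_add, pow_mul, hD, one_pow, one_mul]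
  rw [hmod] at hBm
  have hr : m % 3 < 3 := Nat.mod_lt _ (by norm_num)
  interval_cases hm3 : (m % 3)
  · omega
  · rw [pow_one] at hBm
    rw [hBm] at hC; norm_num at hC
  · rw [hBm] at hC
    have : β = -2 := by linear_combination hC
    rw [this] at hBm; norm_num at hBm

/-- **`M(zⁿ + z + 1) ≤ √3`** (`n ≥ 2`), by Landau's inequality. -/
theorem intMahlerMeasure_X_pow_add_X_add_one_le {n : ℕ} (hn : 2 ≤ n) :
    intMahlerMeasure (X ^ n + X + 1 : ℤ[X]) ≤ Real.sqrt 3 := by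
  unfold intMahlerMeasure
  set p : ℂ[X] := C (1 : ℂ) * X ^ n + C (1 : ℂ) * X ^ 1 + C (1 : ℂ) * X ^ 0 with hp
  have hmap : ((X ^ n + X + 1 : ℤ[X]).map (Int.castRingHom ℂ)) = p := by
    rw [hp]
    simp only [Polynomial.map_add, Polynomial.map_pow, Polynomial.map_X, Polynomial.map_one, map_one,
      pow_one, pow_zero, one_mul]
  rw [hmap]
  refine le_trans (mahlerMeasure_le_sqrt_sum_sq_norm_coeff p) (Real.sqrt_le_sqrt ?_)
  have hsum := sum_norm_sq_coeff_trinomial (1 : ℂ) 1 1 (m₀ := n) (m₁ := 1) (m₂ := 0)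
    (by omega) (by omega) (by omega)
  rw [← hp] at hsum
  have h3 : ‖(1 : ℂ)‖ ^ 2 + ‖(1 : ℂ)‖ ^ 2 + ‖(1 : ℂ)‖ ^ 2 = 3 := by norm_num
  rw [h3] at hsum
  have hle : ∑ i ∈ p.support, ‖p.coeff i‖ ^ 2 ≤ ∑ i ∈ range (p.natDegree + 1), ‖p.coeff i‖ ^ 2 :=
    sum_le_sum_of_subset_of_nonneg supp_subset_range_natDegree_succ (fun i _ _ => sq_nonneg ‖p.coeff i‖)
  linarith

/-- **Selmer's theorem, second family** (Selmer 1956): `zⁿ + z + 1` is irreducible over `ℤ` for every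
`n ≥ 2` with `n ≢ 2 (mod 3)`. -/
theorem irreducible_X_pow_add_X_add_one {n : ℕ} (hn : 2 ≤ n) (h3 : n % 3 ≠ 2) :
    Irreducible (X ^ n + X + 1 : ℤ[X]) := by
  obtain ⟨m, rfl⟩ : ∃ m, n = m + 2 := ⟨n - 2, by omega⟩
  have hm : m % 3 ≠ 0 := by omega
  have hθ := smythTheta_gt
  refine irreducible_of_mahlerMeasure_lt_smythTheta_sq (Or.inl ?_) ?_ ?_ ?_
  · simp [coeff_add, coeff_X_pow, coeff_X_zero, coeff_one_zero]
  · refine lt_of_lt_of_le (by omega : 0 < m + 2) (le_natDegree_of_ne_zero ?_)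
    rw [coeff_add, coeff_add, coeff_X_pow, if_pos rfl, coeff_X, if_neg (by omega), coeff_one,
      if_neg (by omega)]
    norm_num
  · refine lt_of_le_of_lt (intMahlerMeasure_X_pow_add_X_add_one_le hn) ?_
    have h3' : Real.sqrt 3 < 1754 / 1000 := by
      rw [Real.sqrt_lt' (by norm_num)]; norm_num
    nlinarith
  · intro β hβ h1 h2
    simp only [Polynomial.map_add, Polynomial.map_pow, Polynomial.map_X, Polynomial.map_one, eval_add,
      eval_pow, eval_X, eval_one] at h1 h2
    exact X_pow_add_X_add_one_no_inverse_pair hm hβ h1 h2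

end Summit.Ventures.DiscreteObjects.Mahler
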